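import Summits.NavierStokesRegularity.NavierStokesRegularity.Theorems.ExtremiserTransienceDepletedFractionDefs
import Summits.NavierStokesRegularity.NavierStokesRegularity.Theorems.ExtremiserTransienceDepletedFractionWindowGradient
import HarnessLib

/-!
# Crux `NearExtremalTransiencePerFlow` (stmt-NavierStokesRegularity-26567) — X♭ `DepletedFraction` REDUCES to its
# interior-gradient-controlled form (N2 of idea-crit-4 g9 plugged in by name)

`--supports stmt-NavierStokesRegularity-26567` (helper; prover seat ns-net-p2 g12).  The heart X♭ `DepletedFraction` (texts of record
p720463 `…DepletedFractionDefs`) carries a gradient bound only AT the start of the admissible window.  By the window smoothing lemma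
`exists_window_gradient_of_heights` (p723282) the heights hypothesis `‖u(t')‖ ≤ HM` on `I = [t, t + τ₁ν/M²]` already yields
`‖∇u(t')‖ ≤ C(d)(HM)²/ν` on the delayed interior `(t + dν/(HM)², t + τ₁ν/M²)` for every `d > 0`.  Hence X♭ follows from the formally
WEAKER statement in which the prover of the heart may (a) choose any delay `d > 0` and then (b) ASSUME an interior gradient bound with an
arbitrary constant `G'` on the delayed part of the window:

  `∀ Θ G H τ₁ > 0, ∃ d > 0, ∀ G' > 0, ∃ ε > 0, ∀ flows ∀ admissible windows, (interior gradient ≤ G'(HM)²/ν) → |DEPLETED_ε ∩ I| ≥ ε|I|`.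

`depletedFraction_of_interiorGradient` is this reduction (pure bookkeeping over p723282).  HONEST FRAMING: nothing about X♭ itself,
⟨26567⟩ or Navier–Stokes regularity is proved; no summit is proved by a line. [folklore]
-/

noncomputable section

open scoped Topology InnerProductSpace RealInnerProductSpace ENNReal
open MeasureTheory Filter Set Metric
open Literature.Analysis.FluidPDE
open Summit.NavierStokesRegularity.NavierStokesRegularity.Theorems
open Summit.NavierStokesRegularity.NavierStokesRegularity.Theorems.DepletionLadder.KStar.HalfSpace

namespace Summit.NavierStokesRegularity.NavierStokesRegularity.Theorems.NearExtremalTransiencePerFlow.DepletedFraction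

-- the summit's namespace repeats the problem name by convention (D-0017)
set_option linter.dupNamespace false
set_option linter.style.longLine false

/-- **X♭ reduces to its interior-gradient-controlled form.**  If for all `Θ G H τ₁ > 0` there is a delay `d > 0` such that for every
interior-gradient constant `G' > 0` some `ε > 0` makes the depleted-fraction conclusion of `DepletedFraction` hold on every admissible
window whose delayed interior `(t + dν/(HM)², t + τ₁ν/M²)` carries the gradient bound `‖∇u(t', x)‖ ≤ G'(HM)²/ν`, then `DepletedFraction`
holds (the interior bound is supplied by `exists_window_gradient_of_heights`). [folklore] -/
theorem depletedFraction_of_interiorGradient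
    (hR : ∀ (Θ G H τ₁ : ℝ), 0 < Θ → 0 < G → 0 < H → 0 < τ₁ → ∃ d : ℝ, 0 < d ∧ ∀ G' : ℝ, 0 < G' → ∃ ε : ℝ, 0 < ε ∧
      ∀ (ν T : ℝ), 0 < ν → 0 < T →
      ∀ (u : ℝ → EuclideanSpace ℝ (Fin 3) → EuclideanSpace ℝ (Fin 3)) (p : ℝ → EuclideanSpace ℝ (Fin 3) → ℝ),
        IsClassicalNSSolutionOn (Set.Ico 0 T) ν 0 u p → IsLerayHopfOn T ν 0 (u 0) u → HasRapidSpatialDecay (u 0) →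
      ∀ (t M : ℝ), 0 ≤ t → 0 < M → t + τ₁ * ν / M ^ 2 < T →
        (∀ x, ‖u t x‖ ≤ M) →
        (∫ x, ‖curl (u t) x‖ ^ 2) ≤ Θ * (ν / M) ^ 2 * (∫ x, frobeniusNormSq (fderiv ℝ (curl (u t)) x)) →
        (∀ x, ‖fderiv ℝ (u t) x‖ ≤ G * M ^ 2 / ν) →
        (∀ t' ∈ Set.Icc t (t + τ₁ * ν / M ^ 2), ∀ x, ‖u t' x‖ ≤ H * M) →
        (∀ t' ∈ Set.Ioo (t + d * ν / (H * M) ^ 2) (t + τ₁ * ν / M ^ 2), ∀ x, ‖fderiv ℝ (u t') x‖ ≤ G' * (H * M) ^ 2 / ν) →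
        ENNReal.ofReal (ε * (τ₁ * ν / M ^ 2)) ≤
          volume ({t' : ℝ | ∀ M' : ℝ, (∀ x, ‖u t' x‖ ≤ M') →
              |∫ x, ⟪curl (u t') x, fderiv ℝ (u t') x (curl (u t') x)⟫_ℝ| ≤
                (kStar - ε) * M' * Real.sqrt (∫ x, ‖curl (u t') x‖ ^ 2) *
                  Real.sqrt (∫ x, frobeniusNormSq (fderiv ℝ (curl (u t')) x))} ∩
            Set.Icc t (t + τ₁ * ν / M ^ 2))) :
    DepletedFraction := by
  intro Θ G H τ₁ hΘ hG hH hτ₁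
  obtain ⟨d, hd, hR'⟩ := hR Θ G H τ₁ hΘ hG hH hτ₁
  obtain ⟨C, hCpos, hC⟩ := exists_window_gradient_of_heights hd
  obtain ⟨ε, hε, hmain⟩ := hR' C hCpos
  refine ⟨ε, hε, ?_⟩
  intro ν T hν hT u p hsol hLH hdec t M ht hM htT hMb hlock hgrad hheights
  exact hmain ν T hν hT u p hsol hLH hdec t M ht hM htT hMb hlock hgrad hheights
    (hC ν T hν hT u p hsol hLH t M H τ₁ ht hM hH htT hheights)

end Summit.NavierStokesRegularity.NavierStokesRegularity.Theorems.NearExtremalTransiencePerFlow.DepletedFraction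

end
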